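import Summits.QuantumFields.YangMills.Theorems.UnitScaleTiltProp8HalvingDressingLetterFlatScaledX1
import Summits.QuantumFields.YangMills.Theorems.UnitScaleTiltProp8Chart47AnalyticCarrier
import Summits.QuantumFields.YangMills.Theorems.UnitScaleTiltProp8ChartQuadraticFlat
import Summits.QuantumFields.YangMills.Theorems.UnitScaleTiltProp8FlatHScaledExtensionDeriv
import HarnessLib

/-!
# Route `UnitScaleTilt`, crux K1 child «MinimiserStabilityRegPr» (stmt-QuantumFields-19200), registered stub V2′ `stub_halvingStep`
# (skeleton v10 `BirthV10`) — **THE DRESSING LETTER `C_E` ON THE CHART OF RECORD (FILE E, the (S6) instantiation + FILE C knit)** — FILE C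
# `exists_hWq_dressed_cubeSeq_T3_of_columnLetters` (✓ p608349) INSTANTIATED at `H := Hs` (the level-scaled `flatH` extension, RULING g26-№11 (i), ✓ p612533∕p613695),
# `C := C♭ = chartLogFlat η 𝒟 − D(chartLogFlat η 𝒟)(0)` (print's double-bar chart remainder, RULING g26-№6, ✓ (S3) B3 p613442) and `D := Dsel`, THE ANALYTIC (49)-FIXED-POINT
# CHART of ★w7-19936 g2's carrier (✓ p611306 `Chart47AnalyticCarrier.exists_analytic_chartD_of_remainder_T3`), at the aligned cube sequence (144): the four H-side letters
# (FILE D♯∕D♯v2), (55) `hD`, (49) `h49`, the differentiabilities `hDd`∕`hCd` ALL DISCHARGED; displayed residue = the (X2-C′)♭ column letter of `C♭` on a `w 1`-ball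
# (★w8-19936 g0's ✓ p612993 `hCcolFlat_fderiv_of_kernel157` shape, fed by (S3)'s (157) kernel row) and the numeric windows in `ε`, `R_c⁰`, `a₃` (all constants from `L`)

Cell `ym3-torus` (HUMAN RULING D-0037, YM ladder rung R3 — continuum SU(2) YM₃ on the torus is a RUNG, not the Clay problem), width seat `ym-ust-19200-w6`
(D-0154 (3c); ★★OWNER ym3-torus-plan g26 RULING g26-№6 (S6)∕(S7), №7 (2) «(S6) 20-line (X4) instantiation + FILE C knit — w6», №11 (i)).
`--supports stmt-QuantumFields-19200 --as helper`; count-neutral; def-free, 0 sorry, standard axioms.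

WHAT THIS FILE PROVES (sorry-free; no definition).  §1 `hCcol_at_dressedPoint` (bookkeeping: FILE C's `hCcol` at the dressed point from a column letter on a
`w₁`-ball, generic finite index types).  §2 ★★★ **`exists_hWq_dressed_cubeSeq_T3_chartOfRecord`** — for odd `L = ℓ + 1 ≥ 5` there are `M_h⁰, R₀ : ℕ` and
`B_H, C_X, K₀, C_P ≥ 0` (functions of `L` alone) such that for every member `F = ⟨L, m⟩`, heights `1 ≤ K − n`, `K − n + 1 ≤ m + K`, big blocks `M_h = L^{a′} ≥ M_h⁰`,
separation `R ≥ R₀` (`≥ 2L`), `a′ + 3 ≤ m + n`, centre `x₀`, radii `ρ`, `S ≥ R·(L·M_h)`, level weights `w` of `𝒟 = cubeSeqMT3 F n K x₀ ρ S (L·M_h)`, every index weight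
`u ≥ η⁻³(L^{j}η)⁻¹`, every chart radius `ε` in the window `0 < ε`, `3ε ≤ R_s/4`, `9·C₂·B_H·ε < 1` (`R_s = (60800·ℓ̄²·L)⁻¹`, `ℓ̄ = (d+2)L`, `C₂ = 64L/R_s` — (S3)'s constants),
every (X2-C′)♭ column letter `hCcol♭` of slope `C₃` on the `w 1`-ball of radius `R' ≥ (1 + 4B_HC₂ε)ε`, and numerics `C₃(1 + 4B_HC₂ε)εK₀ ≤ ½`, `0 ≤ R_c⁰ < ε`, `a₃ ≤ R_c⁰`,
`(1 + 4B_HC₂R_c⁰)a₃ ≤ 1/(2L)`: THERE ARE `Hs` (the `H` of record: kernel display + `D(chartLogFlat)(0) ∘ Hs = id`), `Dsel` (analytic on the `ε`-ball; (55) `‖Dsel A′‖ ≤ 4C₂ε²`,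
(49) `C♭(A′ − Hs(Dsel A′)) = Dsel A′`, (48) `chartLogFlat(A′ − Hs(Dsel A′)) = D(chartLogFlat)(0) A′`, uniqueness, the sharp (55)) and P3b's `W₀` ((grad) identity, entire) such
that for the EXPLICIT dressing term `E` (`hE` verbatim, FILE A's `dressing_eq_three_terms`) the dressed current satisfies hypothesis (iii) of
✓ `row165_of_tracePairing_L5_anyW`: `w₃(b)·‖(W₀(Y − Hs(Dsel Y)) + E Y)(b)‖ ≤ C₄·r²` for `r < a₃`, `C₄ = C₀θ² + 2C_XC₂ + 8C₃′C_Pθ + 16K₀C₃′R_c⁰C₀θ²`, `C₀ = 12L³(1428 + L)`,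
`θ = 1 + 4B_HC₂R_c⁰`, `C₃′ = C₃(1 + 4B_HC₂ε)` (the dressed point `Y − Hs(Dsel Y)` has `w 1`-size `≤ (1 + 4B_HC₂ε)·r`).
HONEST SCOPE.  Plumbing over landed certificates: B3 (`chartRemainderFlat_hCd_hCq_B1`), the carrier, `exists_flatH_scaledExt_hHinv`, FILE C∕D♯∕D♯v2; the (157) kernel row
behind `hCcol♭` ((S3)∕(S4′)) and the numeric choice of `ε, R_c⁰, a₃` are NOT made here.  NOT a claim about the stub, the crux, the rung or the mass gap; no summit statement
is proved by this seat.

References: T. Bałaban, CMP **102** (1985) 277–309 [Balaban1985Variational] (44)–(50) p.285, (55) p.286, (72)–(73) p.289, (80)–(89) pp.290–291, Prop. 4 (97)–(98)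
pp.292–293, (144) p.300, (152)–(158) pp.301–302, (161)–(163) p.303, (165) p.304; CMP **98** (1985) 17–51 [Balaban1985Averaging] Prop. 5 (156)–(157) p.42; CMP **96**
(1984) 223–250 [Balaban1984PropagatorsII] (2.1)–(2.4) p.224, Cor. 2.8 (2.150)–(2.151) p.249.
-/

set_option autoImplicit false

noncomputable section

open scoped BigOperators Matrix Matrix.Norms.L2Operator
open NormedSpace Filter Topology

namespace Summit.QuantumFields.YangMills.Theorems.HalvingDressingLetter

open Literature.MathematicalPhysics.QuantumFieldTheory.Balaban1983to89
open B6GlobalChartV1 (PV)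
open B6SectADomainsV1 (Domains)
open B6SectAOperatorsV1 (BondIdx)
open T3ContinuumYM3Torus (T3Family)
open FlatCubeOpsText (Adm22 IsLevWeight HSupLetterG)
open FlatOpsLettersAssembly (flatH levWeight_nonneg)
open FlatCubeSequenceAligned (cubeSeqMT3 cubeSeqMT3_k)
open FlatCubeSequenceAdm (adm22_cubeSeqMT3)
open FlatPortBodyL0 (rowsAt_of_adm22)
open FlatHDressingShape (exists_flatH_scaledExt_hHinv)
open Prop8ChartDoubleBar (chartLogFlat chartRemainderFlat_hCd_hCq_B1)
open Chart47AnalyticCarrier (exists_analytic_chartD_of_remainder_T3)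

/-- `1 ≤ 3` (named once; every `PV` below carries the same proof term). [folklore] -/
private theorem hd3 : 1 ≤ 2 + 1 := by norm_num

/-! ## §1 The (X2-C′) column letter at the dressed point `Y − H(D Y)` from a column letter on a `w₁`-ball -/

/-- **(X2-C′) AT THE DRESSED POINT** (bookkeeping, any finite index types): if the (46) sup row of `H` holds with `B_H`, the chart datum obeys (55) `‖D Y‖ ≤ 4C₂r²` below `ε`,
and the column letter of `C′` holds with slope `C₃·ρ′` on the `w₁`-ball of radius `R′ ≥ (1 + 4B_HC₂ε)·ε`, then at every `Y` of size `r < ε` the dressed point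
`Y − H(D Y)` has `w₁`-size `≤ (1 + 4B_HC₂ε)·r` and the column letter holds there with slope `C₃(1 + 4B_HC₂ε)·r` — FILE C's `hCcol` binder from a ball letter
(✓ p612993 `hCcolFlat_fderiv_of_kernel157`'s shape). [cite: Balaban1985Variational, (46) p.285, (55) p.286, (72)-(73) p.289, (152) p.301] -/
theorem hCcol_at_dressedPoint {κ ι V : Type*} [Fintype κ] [Fintype ι] [NormedAddCommGroup V]
    (w₁ w₃ : κ → ℝ) (hw₁ : ∀ b, 0 < w₁ b) (b₀ : κ) (u : ι → ℝ)
    (H : (ι → V) → (κ → V)) (D : (κ → V) → (ι → V)) (C' : (κ → V) → (κ → V) → ι → V) (G : (κ → V) → ℝ → Prop)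
    {BH C₂ ε R' C₃ : ℝ} (hBH : 0 ≤ BH) (hC₂ : 0 ≤ C₂)
    (hH1 : ∀ (X : ι → V) (t : ℝ), (∀ c, ‖X c‖ ≤ t) → ∀ b, w₁ b * ‖H X b‖ ≤ BH * t)
    (hD : ∀ (Y : κ → V) (r : ℝ), r < ε → (∀ b, w₁ b * ‖Y b‖ ≤ r) → G Y r → ∀ c, ‖D Y c‖ ≤ 4 * C₂ * r ^ 2)
    (hCcol : ∀ (Z : κ → V) (ρ' : ℝ), ρ' < R' → (∀ b, w₁ b * ‖Z b‖ ≤ ρ') →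
      ∀ δ : κ → V, ∑ c, u c * ‖C' Z δ c‖ ≤ C₃ * ρ' * ∑ b, (w₃ b)⁻¹ * ‖δ b‖)
    (hR' : (1 + 4 * BH * C₂ * ε) * ε ≤ R') :
    ∀ (Y : κ → V) (r : ℝ), r < ε → (∀ b, w₁ b * ‖Y b‖ ≤ r) → G Y r →
      ∀ δ : κ → V, ∑ c, u c * ‖C' (Y - H (D Y)) δ c‖ ≤ C₃ * (1 + 4 * BH * C₂ * ε) * r * ∑ b, (w₃ b)⁻¹ * ‖δ b‖ := by
  intro Y r hr hY hG δ
  have hr0 : 0 ≤ r := (mul_nonneg (hw₁ b₀).le (norm_nonneg _)).trans (hY b₀)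
  have hDY : ∀ c, ‖D Y c‖ ≤ 4 * C₂ * r ^ 2 := hD Y r hr hY hG
  have h4 : 0 ≤ 4 * BH * C₂ := by positivity
  have hθ : (1 : ℝ) ≤ 1 + 4 * BH * C₂ * ε := by nlinarith [mul_nonneg h4 (hr0.trans hr.le)]
  have hsz : ∀ b, w₁ b * ‖(Y - H (D Y)) b‖ ≤ (1 + 4 * BH * C₂ * ε) * r := by
    intro b
    have h1 : w₁ b * ‖H (D Y) b‖ ≤ BH * (4 * C₂ * r ^ 2) := hH1 (D Y) (4 * C₂ * r ^ 2) hDY b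
    have hkey : 0 ≤ 4 * BH * C₂ * (r * (ε - r)) := mul_nonneg h4 (mul_nonneg hr0 (sub_nonneg.2 hr.le))
    have e : (1 + 4 * BH * C₂ * ε) * r = r + BH * (4 * C₂ * r ^ 2) + 4 * BH * C₂ * (r * (ε - r)) := by ring
    calc w₁ b * ‖(Y - H (D Y)) b‖ = w₁ b * ‖Y b - H (D Y) b‖ := rfl
      _ ≤ w₁ b * (‖Y b‖ + ‖H (D Y) b‖) := mul_le_mul_of_nonneg_left (norm_sub_le _ _) (hw₁ b).le
      _ = w₁ b * ‖Y b‖ + w₁ b * ‖H (D Y) b‖ := mul_add _ _ _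
      _ ≤ r + BH * (4 * C₂ * r ^ 2) := add_le_add (hY b) h1
      _ ≤ (1 + 4 * BH * C₂ * ε) * r := by rw [e]; linarith
  have hρ : (1 + 4 * BH * C₂ * ε) * r < R' := lt_of_lt_of_le (mul_lt_mul_of_pos_left hr (lt_of_lt_of_le one_pos hθ)) hR'
  have h := hCcol (Y - H (D Y)) ((1 + 4 * BH * C₂ * ε) * r) hρ hsz δ
  calc _ ≤ C₃ * ((1 + 4 * BH * C₂ * ε) * r) * ∑ b, (w₃ b)⁻¹ * ‖δ b‖ := h
    _ = C₃ * (1 + 4 * BH * C₂ * ε) * r * ∑ b, (w₃ b)⁻¹ * ‖δ b‖ := by ring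

/-! ## §2 The C_E knit on the chart of record -/

-- heartbeat budget (HOME README rule): the signature alone is ~100 lines; measured: fails at 100k, passes at 150k; budgeted 400k on this declaration only
set_option maxHeartbeats 400000 in
/-- ★★★ **THE DRESSING LETTER `C_E` ON THE CHART OF RECORD** — see the module docstring: FILE C at `H := Hs`, `C := C♭`, `D := Dsel` (the (49) fixed point of ★w7-19936 g2's
analytic carrier over (S3)'s B3), the four H-side letters, (55), (49) and the differentiabilities discharged; displayed: the (X2-C′)♭ column letter on a `w 1`-ball and the
numeric windows. [cite: Balaban1985Variational, (44)-(50) p.285, (55) p.286, (72)-(73) p.289, (80)-(89) pp.290-291, Prop. 4 (97)-(98) pp.292-293, (144) p.300, (152)-(158) pp.301-302, (161)-(163) p.303; Balaban1985Averaging, Prop. 5 (157) p.42] -/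
theorem exists_hWq_dressed_cubeSeq_T3_chartOfRecord (ℓ : ℕ) (hL : Odd (ℓ + 1) ∧ 1 < ℓ + 1) (hℓ : 4 ≤ ℓ) :
    ∃ (Mh₀ R₀ : ℕ) (BH CX K₀ CP : ℝ), 0 ≤ BH ∧ 0 ≤ CX ∧ 0 ≤ K₀ ∧ 0 ≤ CP ∧
    ∀ (m : ℕ) (hm : 1 ≤ m) (n K : ℕ) (_ : 1 ≤ K - n) (_ : K - n + 1 ≤ m + K) {Mh R a' : ℕ} (_ : Mh = (ℓ + 1) ^ a') (_ : Mh₀ ≤ Mh) (_ : R₀ ≤ R)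
      (_ : a' + 3 ≤ m + n) (x₀ : Site (PV 2 ℓ m K hd3 hL) 0) (ρ S : ℕ) (hM : 1 ≤ (ℓ + 1) * Mh) (_ : R * ((ℓ + 1) * Mh) ≤ S)
      (w : ℕ → PBond (PV 2 ℓ m K hd3 hL) 0 → ℝ) (_ : IsLevWeight (⟨ℓ + 1, hL, m, hm⟩ : T3Family) n K (cubeSeqMT3 (⟨ℓ + 1, hL, m, hm⟩ : T3Family) n K x₀ ρ S ((ℓ + 1) * Mh) hM) w)
      (u : BondIdx (cubeSeqMT3 (⟨ℓ + 1, hL, m, hm⟩ : T3Family) n K x₀ ρ S ((ℓ + 1) * Mh) hM) → ℝ) (_ : ∀ c, ((((ℓ + 1 : ℕ) : ℝ)) ^ (K - n)) ^ 3 * ((((ℓ + 1 : ℕ) : ℝ)) ^ (c.1.1 : ℕ) * ((((ℓ + 1 : ℕ) : ℝ))⁻¹) ^ (K - n))⁻¹ ≤ u c)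
      {ε C₃ R' Rc₀ a₃ : ℝ} (_ : 0 < ε) (_ : 3 * ε ≤ (16 * 3800 * (((((PV 2 ℓ m K hd3 hL)).d + 2) * ((PV 2 ℓ m K hd3 hL)).L : ℕ) : ℝ) ^ 2 * ((ℓ + 1 : ℕ) : ℝ))⁻¹ / 4) (_ : 9 * (64 * ((ℓ + 1 : ℕ) : ℝ) / (16 * 3800 * (((((PV 2 ℓ m K hd3 hL)).d + 2) * ((PV 2 ℓ m K hd3 hL)).L : ℕ) : ℝ) ^ 2 * ((ℓ + 1 : ℕ) : ℝ))⁻¹) * BH * ε < 1)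
      (_ : 0 ≤ C₃) (_ : (1 + 4 * BH * (64 * ((ℓ + 1 : ℕ) : ℝ) / (16 * 3800 * (((((PV 2 ℓ m K hd3 hL)).d + 2) * ((PV 2 ℓ m K hd3 hL)).L : ℕ) : ℝ) ^ 2 * ((ℓ + 1 : ℕ) : ℝ))⁻¹) * ε) * ε ≤ R')
      (_ : ∀ (Z : PBond (PV 2 ℓ m K hd3 hL) 0 → Matrix (Fin 2) (Fin 2) ℂ) (ρ' : ℝ), ρ' < R' → (∀ b, w 1 b * ‖Z b‖ ≤ ρ') →
        ∀ δ : PBond (PV 2 ℓ m K hd3 hL) 0 → Matrix (Fin 2) (Fin 2) ℂ,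
          ∑ c, u c * ‖fderiv ℂ (fun A : PBond (PV 2 ℓ m K hd3 hL) 0 → Matrix (Fin 2) (Fin 2) ℂ => chartLogFlat (((((ℓ + 1 : ℕ) : ℝ))⁻¹) ^ (K - n)) (cubeSeqMT3 (⟨ℓ + 1, hL, m, hm⟩ : T3Family) n K x₀ ρ S ((ℓ + 1) * Mh) hM) A - fderiv ℂ (chartLogFlat (((((ℓ + 1 : ℕ) : ℝ))⁻¹) ^ (K - n)) (cubeSeqMT3 (⟨ℓ + 1, hL, m, hm⟩ : T3Family) n K x₀ ρ S ((ℓ + 1) * Mh) hM) : (PBond (PV 2 ℓ m K hd3 hL) 0 → Matrix (Fin 2) (Fin 2) ℂ) → BondIdx (cubeSeqMT3 (⟨ℓ + 1, hL, m, hm⟩ : T3Family) n K x₀ ρ S ((ℓ + 1) * Mh) hM) → Matrix (Fin 2) (Fin 2) ℂ) 0 A) Z δ c‖ ≤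
            C₃ * ρ' * ∑ b, (w 3 b)⁻¹ * ‖δ b‖)
      (_ : C₃ * (1 + 4 * BH * (64 * ((ℓ + 1 : ℕ) : ℝ) / (16 * 3800 * (((((PV 2 ℓ m K hd3 hL)).d + 2) * ((PV 2 ℓ m K hd3 hL)).L : ℕ) : ℝ) ^ 2 * ((ℓ + 1 : ℕ) : ℝ))⁻¹) * ε) * ε * K₀ ≤ 1 / 2) (_ : 0 ≤ Rc₀) (_ : Rc₀ < ε) (_ : a₃ ≤ Rc₀)
      (_ : (1 + 4 * BH * (64 * ((ℓ + 1 : ℕ) : ℝ) / (16 * 3800 * (((((PV 2 ℓ m K hd3 hL)).d + 2) * ((PV 2 ℓ m K hd3 hL)).L : ℕ) : ℝ) ^ 2 * ((ℓ + 1 : ℕ) : ℝ))⁻¹) * Rc₀) * a₃ ≤ 1 / (2 * ((ℓ + 1 : ℕ) : ℝ))),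
    ∃ (Hs : (BondIdx (cubeSeqMT3 (⟨ℓ + 1, hL, m, hm⟩ : T3Family) n K x₀ ρ S ((ℓ + 1) * Mh) hM) → Matrix (Fin 2) (Fin 2) ℂ) →ₗ[ℂ] (PBond (PV 2 ℓ m K hd3 hL) 0 → Matrix (Fin 2) (Fin 2) ℂ))
      (Dsel : (PBond (PV 2 ℓ m K hd3 hL) 0 → Matrix (Fin 2) (Fin 2) ℂ) → BondIdx (cubeSeqMT3 (⟨ℓ + 1, hL, m, hm⟩ : T3Family) n K x₀ ρ S ((ℓ + 1) * Mh) hM) → Matrix (Fin 2) (Fin 2) ℂ)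
      (W₀ : (PBond (PV 2 ℓ m K hd3 hL) 0 → Matrix (Fin 2) (Fin 2) ℂ) → (PBond (PV 2 ℓ m K hd3 hL) 0 → Matrix (Fin 2) (Fin 2) ℂ)),
      (∀ (X : BondIdx (cubeSeqMT3 (⟨ℓ + 1, hL, m, hm⟩ : T3Family) n K x₀ ρ S ((ℓ + 1) * Mh) hM) → Matrix (Fin 2) (Fin 2) ℂ) (b : PBond (PV 2 ℓ m K hd3 hL) 0),
        Hs X b = ∑ c : BondIdx (cubeSeqMT3 (⟨ℓ + 1, hL, m, hm⟩ : T3Family) n K x₀ ρ S ((ℓ + 1) * Mh) hM), (flatH (⟨ℓ + 1, hL, m, hm⟩ : T3Family) n K (cubeSeqMT3 (⟨ℓ + 1, hL, m, hm⟩ : T3Family) n K x₀ ρ S ((ℓ + 1) * Mh) hM) (Pi.single c 1) b * ((((ℓ + 1 : ℕ) : ℝ)) ^ (c.1.1 : ℕ) * ((((ℓ + 1 : ℕ) : ℝ))⁻¹) ^ (K - n))⁻¹) • X c) ∧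
      (∀ X : BondIdx (cubeSeqMT3 (⟨ℓ + 1, hL, m, hm⟩ : T3Family) n K x₀ ρ S ((ℓ + 1) * Mh) hM) → Matrix (Fin 2) (Fin 2) ℂ, (fderiv ℂ (chartLogFlat (((((ℓ + 1 : ℕ) : ℝ))⁻¹) ^ (K - n)) (cubeSeqMT3 (⟨ℓ + 1, hL, m, hm⟩ : T3Family) n K x₀ ρ S ((ℓ + 1) * Mh) hM) : (PBond (PV 2 ℓ m K hd3 hL) 0 → Matrix (Fin 2) (Fin 2) ℂ) → BondIdx (cubeSeqMT3 (⟨ℓ + 1, hL, m, hm⟩ : T3Family) n K x₀ ρ S ((ℓ + 1) * Mh) hM) → Matrix (Fin 2) (Fin 2) ℂ) 0) (Hs X) = X) ∧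
      (∀ (X : BondIdx (cubeSeqMT3 (⟨ℓ + 1, hL, m, hm⟩ : T3Family) n K x₀ ρ S ((ℓ + 1) * Mh) hM) → Matrix (Fin 2) (Fin 2) ℂ) (t : ℝ), (∀ c, ‖X c‖ ≤ t) →
        (∀ b, w 1 b * ‖Hs X b‖ ≤ BH * t) ∧
        ∀ (b : PBond (PV 2 ℓ m K hd3 hL) 0) (ν : Fin 3), w 2 b * ((ℓ + 1 : ℕ) : ℝ) ^ (K - n) * ‖Hs X ⟨b.src.shift ν, b.dir⟩ - Hs X b‖ ≤ BH * t) ∧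
      AnalyticOnNhd ℂ Dsel {A' : PBond (PV 2 ℓ m K hd3 hL) 0 → Matrix (Fin 2) (Fin 2) ℂ | ∀ b, w 1 b * ‖A' b‖ < ε} ∧
      DifferentiableOn ℂ (fderiv ℂ Dsel) {A' : PBond (PV 2 ℓ m K hd3 hL) 0 → Matrix (Fin 2) (Fin 2) ℂ | ∀ b, w 1 b * ‖A' b‖ < ε} ∧
      (∀ A' : PBond (PV 2 ℓ m K hd3 hL) 0 → Matrix (Fin 2) (Fin 2) ℂ, (∀ b, w 1 b * ‖A' b‖ < ε) →
        (∀ c, ‖Dsel A' c‖ ≤ 4 * (64 * ((ℓ + 1 : ℕ) : ℝ) / (16 * 3800 * (((((PV 2 ℓ m K hd3 hL)).d + 2) * ((PV 2 ℓ m K hd3 hL)).L : ℕ) : ℝ) ^ 2 * ((ℓ + 1 : ℕ) : ℝ))⁻¹) * ε ^ 2) ∧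
        chartLogFlat (((((ℓ + 1 : ℕ) : ℝ))⁻¹) ^ (K - n)) (cubeSeqMT3 (⟨ℓ + 1, hL, m, hm⟩ : T3Family) n K x₀ ρ S ((ℓ + 1) * Mh) hM) (A' - Hs (Dsel A')) - (fderiv ℂ (chartLogFlat (((((ℓ + 1 : ℕ) : ℝ))⁻¹) ^ (K - n)) (cubeSeqMT3 (⟨ℓ + 1, hL, m, hm⟩ : T3Family) n K x₀ ρ S ((ℓ + 1) * Mh) hM) : (PBond (PV 2 ℓ m K hd3 hL) 0 → Matrix (Fin 2) (Fin 2) ℂ) → BondIdx (cubeSeqMT3 (⟨ℓ + 1, hL, m, hm⟩ : T3Family) n K x₀ ρ S ((ℓ + 1) * Mh) hM) → Matrix (Fin 2) (Fin 2) ℂ) 0) (A' - Hs (Dsel A')) = Dsel A' ∧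
        chartLogFlat (((((ℓ + 1 : ℕ) : ℝ))⁻¹) ^ (K - n)) (cubeSeqMT3 (⟨ℓ + 1, hL, m, hm⟩ : T3Family) n K x₀ ρ S ((ℓ + 1) * Mh) hM) (A' - Hs (Dsel A')) = (fderiv ℂ (chartLogFlat (((((ℓ + 1 : ℕ) : ℝ))⁻¹) ^ (K - n)) (cubeSeqMT3 (⟨ℓ + 1, hL, m, hm⟩ : T3Family) n K x₀ ρ S ((ℓ + 1) * Mh) hM) : (PBond (PV 2 ℓ m K hd3 hL) 0 → Matrix (Fin 2) (Fin 2) ℂ) → BondIdx (cubeSeqMT3 (⟨ℓ + 1, hL, m, hm⟩ : T3Family) n K x₀ ρ S ((ℓ + 1) * Mh) hM) → Matrix (Fin 2) (Fin 2) ℂ) 0) A' ∧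
        (∀ D' : BondIdx (cubeSeqMT3 (⟨ℓ + 1, hL, m, hm⟩ : T3Family) n K x₀ ρ S ((ℓ + 1) * Mh) hM) → Matrix (Fin 2) (Fin 2) ℂ, (∀ c, ‖D' c‖ ≤ 4 * (64 * ((ℓ + 1 : ℕ) : ℝ) / (16 * 3800 * (((((PV 2 ℓ m K hd3 hL)).d + 2) * ((PV 2 ℓ m K hd3 hL)).L : ℕ) : ℝ) ^ 2 * ((ℓ + 1 : ℕ) : ℝ))⁻¹) * ε ^ 2) →
          chartLogFlat (((((ℓ + 1 : ℕ) : ℝ))⁻¹) ^ (K - n)) (cubeSeqMT3 (⟨ℓ + 1, hL, m, hm⟩ : T3Family) n K x₀ ρ S ((ℓ + 1) * Mh) hM) (A' - Hs D') - (fderiv ℂ (chartLogFlat (((((ℓ + 1 : ℕ) : ℝ))⁻¹) ^ (K - n)) (cubeSeqMT3 (⟨ℓ + 1, hL, m, hm⟩ : T3Family) n K x₀ ρ S ((ℓ + 1) * Mh) hM) : (PBond (PV 2 ℓ m K hd3 hL) 0 → Matrix (Fin 2) (Fin 2) ℂ) → BondIdx (cubeSeqMT3 (⟨ℓ + 1,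 hL, m, hm⟩ : T3Family) n K x₀ ρ S ((ℓ + 1) * Mh) hM) → Matrix (Fin 2) (Fin 2) ℂ) 0) (A' - Hs D') = D' → D' = Dsel A') ∧
        (∀ ρ' : ℝ, 0 ≤ ρ' → (∀ b, w 1 b * ‖A' b‖ ≤ ρ') → ∀ c, ‖Dsel A' c‖ ≤ 4 * (64 * ((ℓ + 1 : ℕ) : ℝ) / (16 * 3800 * (((((PV 2 ℓ m K hd3 hL)).d + 2) * ((PV 2 ℓ m K hd3 hL)).L : ℕ) : ℝ) ^ 2 * ((ℓ + 1 : ℕ) : ℝ))⁻¹) * ρ' ^ 2)) ∧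
      (∀ (Y : PBond (PV 2 ℓ m K hd3 hL) 0 → Matrix (Fin 2) (Fin 2) ℂ) (r : ℝ), r < ε → (∀ b, w 1 b * ‖Y b‖ ≤ r) → (∀ (b : PBond (PV 2 ℓ m K hd3 hL) 0) (ν : Fin 3), w 2 b * ((ℓ + 1 : ℕ) : ℝ) ^ (K - n) * ‖Y ⟨b.src.shift ν, b.dir⟩ - Y b‖ ≤ r) →
        ∀ c, ‖Dsel Y c‖ ≤ 4 * (64 * ((ℓ + 1 : ℕ) : ℝ) / (16 * 3800 * (((((PV 2 ℓ m K hd3 hL)).d + 2) * ((PV 2 ℓ m K hd3 hL)).L : ℕ) : ℝ) ^ 2 * ((ℓ + 1 : ℕ) : ℝ))⁻¹) * r ^ 2) ∧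
      (∀ (Y : PBond (PV 2 ℓ m K hd3 hL) 0 → Matrix (Fin 2) (Fin 2) ℂ) (r : ℝ), r < ε → (∀ b, w 1 b * ‖Y b‖ ≤ r) → (∀ (b : PBond (PV 2 ℓ m K hd3 hL) 0) (ν : Fin 3), w 2 b * ((ℓ + 1 : ℕ) : ℝ) ^ (K - n) * ‖Y ⟨b.src.shift ν, b.dir⟩ - Y b‖ ≤ r) →
        ∀ᶠ X in 𝓝 Y, Dsel X = (fun Z : PBond (PV 2 ℓ m K hd3 hL) 0 → Matrix (Fin 2) (Fin 2) ℂ => chartLogFlat (((((ℓ + 1 : ℕ) : ℝ))⁻¹) ^ (K - n)) (cubeSeqMT3 (⟨ℓ + 1, hL, m, hm⟩ : T3Family) n K x₀ ρ S ((ℓ + 1) * Mh) hM) Z - fderiv ℂ (chartLogFlat (((((ℓ + 1 : ℕ) : ℝ))⁻¹) ^ (K - n)) (cubeSeqMT3 (⟨ℓ + 1, hL, m, hm⟩ : T3Family) n K x₀ ρ S ((ℓ + 1) * Mh) hM) : (PBond (PV 2 ℓ m K hd3 hL) 0 → Matrix (Fin 2) (Fin 2) ℂ) → BondIdx (cubeSeqMT3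 (⟨ℓ + 1, hL, m, hm⟩ : T3Family) n K x₀ ρ S ((ℓ + 1) * Mh) hM) → Matrix (Fin 2) (Fin 2) ℂ) 0 Z) (X - Hs (Dsel X))) ∧
      (∀ (Y : PBond (PV 2 ℓ m K hd3 hL) 0 → Matrix (Fin 2) (Fin 2) ℂ) (r : ℝ), r < ε → (∀ b, w 1 b * ‖Y b‖ ≤ r) → (∀ (b : PBond (PV 2 ℓ m K hd3 hL) 0) (ν : Fin 3), w 2 b * ((ℓ + 1 : ℕ) : ℝ) ^ (K - n) * ‖Y ⟨b.src.shift ν, b.dir⟩ - Y b‖ ≤ r) →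
        DifferentiableAt ℂ Dsel Y) ∧
      (∀ (Y : PBond (PV 2 ℓ m K hd3 hL) 0 → Matrix (Fin 2) (Fin 2) ℂ) (r : ℝ), r < ε → (∀ b, w 1 b * ‖Y b‖ ≤ r) → (∀ (b : PBond (PV 2 ℓ m K hd3 hL) 0) (ν : Fin 3), w 2 b * ((ℓ + 1 : ℕ) : ℝ) ^ (K - n) * ‖Y ⟨b.src.shift ν, b.dir⟩ - Y b‖ ≤ r) →
        DifferentiableAt ℂ (fun Z : PBond (PV 2 ℓ m K hd3 hL) 0 → Matrix (Fin 2) (Fin 2) ℂ => chartLogFlat (((((ℓ + 1 : ℕ) : ℝ))⁻¹) ^ (K - n)) (cubeSeqMT3 (⟨ℓ + 1, hL, m, hm⟩ : T3Family) n K x₀ ρ S ((ℓ + 1) * Mh) hM) Z - fderiv ℂ (chartLogFlat (((((ℓ + 1 : ℕ) : ℝ))⁻¹) ^ (K - n)) (cubeSeqMT3 (⟨ℓ + 1, hL, m, hm⟩ : T3Family) n K x₀ ρ S ((ℓ + 1) * Mh) hM) : (PBond (PV 2 ℓ m K hd3 hL) 0 → Matrix (Fin 2) (Fin 2) ℂ)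 → BondIdx (cubeSeqMT3 (⟨ℓ + 1, hL, m, hm⟩ : T3Family) n K x₀ ρ S ((ℓ + 1) * Mh) hM) → Matrix (Fin 2) (Fin 2) ℂ) 0 Z) (Y - Hs (Dsel Y))) ∧
      (∀ A' : PBond (PV 2 ℓ m K hd3 hL) 0 → Matrix (Fin 2) (Fin 2) ℂ, (∀ b, w 1 b * ‖A' b‖ < ε) → ∀ ρ' : ℝ, 0 ≤ ρ' → (∀ b, w 1 b * ‖A' b‖ ≤ ρ') →
        ∀ (W : PBond (PV 2 ℓ m K hd3 hL) 0 → Matrix (Fin 2) (Fin 2) ℂ) (t : ℝ), 0 ≤ t → (∀ b, w 1 b * ‖W b‖ ≤ t) →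
          ∀ c, ‖fderiv ℂ Dsel A' W c‖ ≤ 9 * (64 * ((ℓ + 1 : ℕ) : ℝ) / (16 * 3800 * (((((PV 2 ℓ m K hd3 hL)).d + 2) * ((PV 2 ℓ m K hd3 hL)).L : ℕ) : ℝ) ^ 2 * ((ℓ + 1 : ℕ) : ℝ))⁻¹) * ρ' * (1 - 9 * (64 * ((ℓ + 1 : ℕ) : ℝ) / (16 * 3800 * (((((PV 2 ℓ m K hd3 hL)).d + 2) * ((PV 2 ℓ m K hd3 hL)).L : ℕ) : ℝ) ^ 2 * ((ℓ + 1 : ℕ) : ℝ))⁻¹) * BH * ε)⁻¹ * t) ∧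
      (∀ A δ : PBond (PV 2 ℓ m K hd3 hL) 0 → Matrix (Fin 2) (Fin 2) ℂ, fderiv ℂ (fun A : PBond (PV 2 ℓ m K hd3 hL) 0 → Matrix (Fin 2) (Fin 2) ℂ => (∑ p : Plaq (PV 2 ℓ m K hd3 hL) 0, (1 - (2 : ℂ)⁻¹ * Matrix.trace (exp ((Complex.I * ((((((ℓ + 1 : ℕ) : ℝ)⁻¹) ^ (K - n) : ℝ)) : ℂ)) • A ⟨p.src, p.μ⟩) * exp ((Complex.I * ((((((ℓ + 1 : ℕ) : ℝ)⁻¹) ^ (K - n) : ℝ)) : ℂ)) • A ⟨p.src.shift p.μ, p.ν⟩) * exp (-((Complex.I * ((((((ℓ + 1 : ℕ) : ℝ)⁻¹) ^ (K - n) : ℝ)) : ℂ)) • A ⟨p.src.shift p.ν, p.μ⟩)) * exp (-((Complex.I * ((((((ℓ + 1 : ℕ) : ℝ)⁻¹) ^ (K - n) : ℝ)) : ℂ)) • A ⟨p.src, p.ν⟩))) + (2 : ℂ)⁻¹ * Matrix.trace (((Complex.I * ((((((ℓ + 1 : ℕ) : ℝ)⁻¹) ^ (K - n) : ℝ)) :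 ℂ)) • A ⟨p.src, p.μ⟩) + ((Complex.I * ((((((ℓ + 1 : ℕ) : ℝ)⁻¹) ^ (K - n) : ℝ)) : ℂ)) • A ⟨p.src.shift p.μ, p.ν⟩) + (-((Complex.I * ((((((ℓ + 1 : ℕ) : ℝ)⁻¹) ^ (K - n) : ℝ)) : ℂ)) • A ⟨p.src.shift p.ν, p.μ⟩)) + (-((Complex.I * ((((((ℓ + 1 : ℕ) : ℝ)⁻¹) ^ (K - n) : ℝ)) : ℂ)) • A ⟨p.src, p.ν⟩))) + (4 : ℂ)⁻¹ * Matrix.trace ((((Complex.I * ((((((ℓ + 1 : ℕ) : ℝ)⁻¹) ^ (K - n) : ℝ)) : ℂ)) • A ⟨p.src, p.μ⟩) + ((Complex.I * ((((((ℓ + 1 : ℕ) : ℝ)⁻¹) ^ (K - n) : ℝ)) : ℂ)) • A ⟨p.src.shift p.μ, p.ν⟩) + (-((Complex.I * ((((((ℓ + 1 : ℕ) : ℝ)⁻¹) ^ (K - n) : ℝ)) : ℂ)) • A ⟨p.src.shift p.ν, p.μ⟩)) + (-((Complex.I * ((((((ℓ + 1 : ℕ) : ℝ)⁻¹) ^ (K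 - n) : ℝ)) : ℂ)) • A ⟨p.src, p.ν⟩))) ^ 2)))) A δ =
        (((((ℓ + 1 : ℕ) : ℝ)⁻¹) ^ (K - n) : ℝ) : ℂ) ^ 4 * ∑ b : PBond (PV 2 ℓ m K hd3 hL) 0, Matrix.trace (W₀ A b * δ b)) ∧
      Differentiable ℂ W₀ ∧
      ∀ E : (PBond (PV 2 ℓ m K hd3 hL) 0 → Matrix (Fin 2) (Fin 2) ℂ) → (PBond (PV 2 ℓ m K hd3 hL) 0 → Matrix (Fin 2) (Fin 2) ℂ),
        (∀ (Y : PBond (PV 2 ℓ m K hd3 hL) 0 → Matrix (Fin 2) (Fin 2) ℂ) (b : PBond (PV 2 ℓ m K hd3 hL) 0) (i j : Fin 2), E Y b i j = (((((((ℓ + 1 : ℕ) : ℝ)⁻¹) ^ (K - n)) : ℝ) : ℂ) ^ 4)⁻¹ *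
          (-((((((((ℓ + 1 : ℕ) : ℝ)⁻¹) ^ (K - n)) : ℝ) : ℂ) ^ 2 / 2) * ∑ p : Plaq (PV 2 ℓ m K hd3 hL) 0, Matrix.trace ((Hs (Dsel Y) ⟨p.src, p.μ⟩ + Hs (Dsel Y) ⟨p.src.shift p.μ, p.ν⟩ - Hs (Dsel Y) ⟨p.src.shift p.ν, p.μ⟩ - Hs (Dsel Y) ⟨p.src, p.ν⟩) *
              (((Pi.single b (Matrix.single j i (1 : ℂ)) : PBond (PV 2 ℓ m K hd3 hL) 0 → Matrix (Fin 2) (Fin 2) ℂ)) ⟨p.src, p.μ⟩ + ((Pi.single b (Matrix.single j i (1 : ℂ)) : PBond (PV 2 ℓ m K hd3 hL) 0 → Matrix (Fin 2) (Fin 2) ℂ)) ⟨p.src.shift p.μ, p.ν⟩ -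
                ((Pi.single b (Matrix.single j i (1 : ℂ)) : PBond (PV 2 ℓ m K hd3 hL) 0 → Matrix (Fin 2) (Fin 2) ℂ)) ⟨p.src.shift p.ν, p.μ⟩ - ((Pi.single b (Matrix.single j i (1 : ℂ)) : PBond (PV 2 ℓ m K hd3 hL) 0 → Matrix (Fin 2) (Fin 2) ℂ)) ⟨p.src, p.ν⟩)))
            - (((((((ℓ + 1 : ℕ) : ℝ)⁻¹) ^ (K - n)) : ℝ) : ℂ) ^ 2 / 2) * ∑ p : Plaq (PV 2 ℓ m K hd3 hL) 0, Matrix.trace (((Y - Hs (Dsel Y)) ⟨p.src, p.μ⟩ + (Y - Hs (Dsel Y)) ⟨p.src.shift p.μ, p.ν⟩ - (Y - Hs (Dsel Y)) ⟨p.src.shift p.ν, p.μ⟩ - (Y - Hs (Dsel Y)) ⟨p.src, p.ν⟩) *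
              (Hs (fderiv ℂ Dsel Y (Pi.single b (Matrix.single j i (1 : ℂ)))) ⟨p.src, p.μ⟩ + Hs (fderiv ℂ Dsel Y (Pi.single b (Matrix.single j i (1 : ℂ)))) ⟨p.src.shift p.μ, p.ν⟩ -
                Hs (fderiv ℂ Dsel Y (Pi.single b (Matrix.single j i (1 : ℂ)))) ⟨p.src.shift p.ν, p.μ⟩ - Hs (fderiv ℂ Dsel Y (Pi.single b (Matrix.single j i (1 : ℂ)))) ⟨p.src, p.ν⟩))
            - ((((((ℓ + 1 : ℕ) : ℝ)⁻¹) ^ (K - n)) : ℝ) : ℂ) ^ 4 * ∑ b' : PBond (PV 2 ℓ m K hd3 hL) 0, Matrix.trace (W₀ (Y - Hs (Dsel Y)) b' * Hs (fderiv ℂ Dsel Y (Pi.single b (Matrix.single j i (1 : ℂ)))) b'))) →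
        ∀ (Y : PBond (PV 2 ℓ m K hd3 hL) 0 → Matrix (Fin 2) (Fin 2) ℂ) (r : ℝ), r < a₃ → (∀ b, w 1 b * ‖Y b‖ ≤ r) →
          (∀ (b : PBond (PV 2 ℓ m K hd3 hL) 0) (ν : Fin 3), w 2 b * ((ℓ + 1 : ℕ) : ℝ) ^ (K - n) * ‖Y ⟨b.src.shift ν, b.dir⟩ - Y b‖ ≤ r) →
          ∀ b, w 3 b * ‖(W₀ (Y - Hs (Dsel Y)) + E Y) b‖ ≤
            (12 * (((ℓ + 1 : ℕ) : ℝ) ^ 3 * (1428 + ((ℓ + 1 : ℕ) : ℝ))) * (1 + 4 * BH * (64 * ((ℓ + 1 : ℕ) : ℝ) / (16 * 3800 * (((((PV 2 ℓ m K hd3 hL)).d + 2) * ((PV 2 ℓ m K hd3 hL)).L : ℕ) : ℝ) ^ 2 * ((ℓ + 1 : ℕ) : ℝ))⁻¹) * Rc₀) ^ 2 +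
              (2 * CX * (64 * ((ℓ + 1 : ℕ) : ℝ) / (16 * 3800 * (((((PV 2 ℓ m K hd3 hL)).d + 2) * ((PV 2 ℓ m K hd3 hL)).L : ℕ) : ℝ) ^ 2 * ((ℓ + 1 : ℕ) : ℝ))⁻¹) + 2⁻¹ * (8 * (C₃ * (1 + 4 * BH * (64 * ((ℓ + 1 : ℕ) : ℝ) / (16 * 3800 * (((((PV 2 ℓ m K hd3 hL)).d + 2) * ((PV 2 ℓ m K hd3 hL)).L : ℕ) : ℝ) ^ 2 * ((ℓ + 1 : ℕ) : ℝ))⁻¹) * ε)) * (2 * CP)) * (1 + 4 * BH * (64 * ((ℓ + 1 : ℕ) : ℝ) / (16 * 3800 * (((((PV 2 ℓ m K hd3 hL)).d + 2) * ((PV 2 ℓ m K hd3 hL)).L : ℕ) : ℝ) ^ 2 * ((ℓ + 1 : ℕ) : ℝ))⁻¹) * Rc₀) +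
                (16 * K₀ * (C₃ * (1 + 4 * BH * (64 * ((ℓ + 1 : ℕ) : ℝ) / (16 * 3800 * (((((PV 2 ℓ m K hd3 hL)).d + 2) * ((PV 2 ℓ m K hd3 hL)).L : ℕ) : ℝ) ^ 2 * ((ℓ + 1 : ℕ) : ℝ))⁻¹) * ε))) * Rc₀ * (12 * (((ℓ + 1 : ℕ) : ℝ) ^ 3 * (1428 + ((ℓ + 1 : ℕ) : ℝ)))) * (1 + 4 * BH * (64 * ((ℓ + 1 : ℕ) : ℝ) / (16 * 3800 * (((((PV 2 ℓ m K hd3 hL)).d + 2) * ((PV 2 ℓ m K hd3 hL)).L : ℕ) : ℝ) ^ 2 * ((ℓ + 1 : ℕ) : ℝ))⁻¹) * Rc₀) ^ 2)) * r ^ 2 := by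
  obtain ⟨Mh₁, R₁, BH, K₀, CP, hBH, hK₀, hCP, hletters⟩ := hLetters_flatHs_of_adm22 ℓ hL hℓ
  obtain ⟨Mh₂, R₂, CX, hCX, hx1⟩ := hX1_flatHs_of_adm22 ℓ hL hℓ
  obtain ⟨Mh₃, R₃, C, δ₀, B₃, CG, -, -, -, -, hrows⟩ := rowsAt_of_adm22 ℓ hL hℓ
  refine ⟨max (max Mh₁ Mh₂) (max Mh₃ 2), max (max R₁ R₂) (max R₃ (2 * (ℓ + 1))), BH, CX, K₀, CP, hBH, hCX, hK₀, hCP, ?_⟩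
  intro m hm n K hk1 hk' Mh R a' hMha hMh hR hsize x₀ ρ S hM hRS w hw u hu ε C₃ R' Rc₀ a₃ hε h3ε hq hC₃ hR' hCcol hsmall hR₀0 hR₀ ha₃ hθ
  -- thresholds
  have hMh₁ : Mh₁ ≤ Mh := le_trans (le_trans (le_max_left _ _) (le_max_left _ _)) hMh
  have hMh₂ : Mh₂ ≤ Mh := le_trans (le_trans (le_max_right _ _) (le_max_left _ _)) hMh
  have hMh₃ : Mh₃ ≤ Mh := le_trans (le_trans (le_max_left _ _) (le_max_right _ _)) hMh
  have hMh2 : 2 ≤ Mh := le_trans (le_trans (le_max_right _ _) (le_max_right _ _)) hMh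
  have hR₁ : R₁ ≤ R := le_trans (le_trans (le_max_left _ _) (le_max_left _ _)) hR
  have hR₂ : R₂ ≤ R := le_trans (le_trans (le_max_right _ _) (le_max_left _ _)) hR
  have hR₃ : R₃ ≤ R := le_trans (le_trans (le_max_left _ _) (le_max_right _ _)) hR
  have hR2L : 2 * (ℓ + 1) ≤ R := le_trans (le_trans (le_max_right _ _) (le_max_right _ _)) hR
  -- the datum: admissible, top level `K − n`, separations
  have hAdm : Adm22 (cubeSeqMT3 (⟨ℓ + 1, hL, m, hm⟩ : T3Family) n K x₀ ρ S ((ℓ + 1) * Mh) hM) R ((ℓ + 1) * Mh) := adm22_cubeSeqMT3 (⟨ℓ + 1, hL, m, hm⟩ : T3Family) n K x₀ ρ hM hRS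
  have hDk : (cubeSeqMT3 (⟨ℓ + 1, hL, m, hm⟩ : T3Family) n K x₀ ρ S ((ℓ + 1) * Mh) hM).k = K - n := cubeSeqMT3_k (⟨ℓ + 1, hL, m, hm⟩ : T3Family) n K x₀ ρ S ((ℓ + 1) * Mh) hM
  have hS : 2 * ((⟨ℓ + 1, hL, m, hm⟩ : T3Family)).L ≤ S := by
    show 2 * (ℓ + 1) ≤ S
    have hR1 : 1 ≤ R := le_trans (by omega) hR2L
    calc 2 * (ℓ + 1) = 1 * ((ℓ + 1) * 2) := by ring
      _ ≤ R * ((ℓ + 1) * Mh) := Nat.mul_le_mul hR1 (Nat.mul_le_mul_left _ hMh2)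
      _ ≤ S := hRS
  have hRL : 2 * ((⟨ℓ + 1, hL, m, hm⟩ : T3Family).P K).L ≤ R := by
    show 2 * (ℓ + 1) ≤ R
    exact hR2L
  -- positivities
  have hL0 : (0 : ℝ) < ((ℓ + 1 : ℕ) : ℝ) := by positivity
  have hη3 : (0 : ℝ) ≤ ((((ℓ + 1 : ℕ) : ℝ)) ^ (K - n)) ^ 3 := by positivity
  have hlam : ∀ c : BondIdx (cubeSeqMT3 (⟨ℓ + 1, hL, m, hm⟩ : T3Family) n K x₀ ρ S ((ℓ + 1) * Mh) hM), (0 : ℝ) < ((((ℓ + 1 : ℕ) : ℝ)) ^ (c.1.1 : ℕ) * ((((ℓ + 1 : ℕ) : ℝ))⁻¹) ^ (K - n)) := fun c => by positivity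
  have hu0 : ∀ c, 0 ≤ u c := fun c => (mul_nonneg hη3 (inv_pos.2 (hlam c)).le).trans (hu c)
  have hw1 : ∀ b, 0 < w 1 b := fun b => by
    rw [hw 1 b]
    exact pow_pos (mul_pos (pow_pos hL0 _) (pow_pos (inv_pos.2 hL0) _)) 1
  have hC₂0 : (0 : ℝ) ≤ (64 * ((ℓ + 1 : ℕ) : ℝ) / (16 * 3800 * (((((PV 2 ℓ m K hd3 hL)).d + 2) * ((PV 2 ℓ m K hd3 hL)).L : ℕ) : ℝ) ^ 2 * ((ℓ + 1 : ℕ) : ℝ))⁻¹) := by positivity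
  have hCP2 : 0 ≤ 2 * CP := by positivity
  have hC₃' : (0 : ℝ) ≤ C₃ * (1 + 4 * BH * (64 * ((ℓ + 1 : ℕ) : ℝ) / (16 * 3800 * (((((PV 2 ℓ m K hd3 hL)).d + 2) * ((PV 2 ℓ m K hd3 hL)).L : ℕ) : ℝ) ^ 2 * ((ℓ + 1 : ℕ) : ℝ))⁻¹) * ε) := by
    have : (0 : ℝ) ≤ 4 * BH * (64 * ((ℓ + 1 : ℕ) : ℝ) / (16 * 3800 * (((((PV 2 ℓ m K hd3 hL)).d + 2) * ((PV 2 ℓ m K hd3 hL)).L : ℕ) : ℝ) ^ 2 * ((ℓ + 1 : ℕ) : ℝ))⁻¹) * ε := by positivity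
    exact mul_nonneg hC₃ (by linarith)
  -- `Hs` of record: P2's first row-list entry at the datum, the scaled extension with its `fderiv` right-inverse identity
  have hsup : HSupLetterG (⟨ℓ + 1, hL, m, hm⟩ : T3Family) n K (cubeSeqMT3 (⟨ℓ + 1, hL, m, hm⟩ : T3Family) n K x₀ ρ S ((ℓ + 1) * Mh) hM) w (flatH (⟨ℓ + 1, hL, m, hm⟩ : T3Family) n K (cubeSeqMT3 (⟨ℓ + 1, hL, m, hm⟩ : T3Family) n K x₀ ρ S ((ℓ + 1) * Mh) hM)) (max C (C * B₃)) := by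
    obtain ⟨⟨h1, -, -⟩, -, -⟩ := hrows m hm n K hk1 hk' hMha hMh₃ hR₃ hsize (cubeSeqMT3 (⟨ℓ + 1, hL, m, hm⟩ : T3Family) n K x₀ ρ S ((ℓ + 1) * Mh) hM) hDk hAdm w hw
    exact h1
  obtain ⟨Hs, hHS, hHinv, -, -⟩ := exists_flatH_scaledExt_hHinv (⟨ℓ + 1, hL, m, hm⟩ : T3Family) n K (cubeSeqMT3 (⟨ℓ + 1, hL, m, hm⟩ : T3Family) n K x₀ ρ S ((ℓ + 1) * Mh) hM) w hw hsup
  -- the four H-side letters at `Hs`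
  obtain ⟨hH, -, hHcol, hCH⟩ := hletters m hm n K hk1 hk' hMha hMh₁ hR₁ hsize (cubeSeqMT3 (⟨ℓ + 1, hL, m, hm⟩ : T3Family) n K x₀ ρ S ((ℓ + 1) * Mh) hM) hDk hAdm w hw Hs hHS u hu
  have hX1 := hx1 m hm n K hk1 hk' hMha hMh₂ hR₂ hsize (cubeSeqMT3 (⟨ℓ + 1, hL, m, hm⟩ : T3Family) n K x₀ ρ S ((ℓ + 1) * Mh) hM) hDk hAdm w hw Hs hHS
  -- the chart of record: (S3) B3's differentiability and quadratic remainder below `Rs/4`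
  obtain ⟨hΦd, hΦq⟩ := chartRemainderFlat_hCd_hCq_B1 (⟨ℓ + 1, hL, m, hm⟩ : T3Family) n K hRL hM (cubeSeqMT3 (⟨ℓ + 1, hL, m, hm⟩ : T3Family) n K x₀ ρ S ((ℓ + 1) * Mh) hM) hDk hAdm hw
  -- (S6): the analytic chart `Dsel` of the (49) fixed point, with (S3)'s constants in the displayed currency
  obtain ⟨Dsel, han, hfd, hpt, hD, h49, hDd, hCd, h73⟩ :=
    exists_analytic_chartD_of_remainder_T3 (⟨ℓ + 1, hL, m, hm⟩ : T3Family) n K hw1 (chartLogFlat (((((ℓ + 1 : ℕ) : ℝ))⁻¹) ^ (K - n)) (cubeSeqMT3 (⟨ℓ + 1, hL, m, hm⟩ : T3Family) n K x₀ ρ S ((ℓ + 1) * Mh) hM) : (PBond (PV 2 ℓ m K hd3 hL) 0 → Matrix (Fin 2) (Fin 2) ℂ) → BondIdx (cubeSeqMT3 (⟨ℓ + 1, hL, m, hm⟩ : T3Family) n K x₀ ρ S ((ℓ + 1) * Mh) hM) → Matrix (Fin 2) (Fin 2) ℂ) (fderiv ℂ (chartLogFlat (((((ℓ + 1 : ℕ)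 : ℝ))⁻¹) ^ (K - n)) (cubeSeqMT3 (⟨ℓ + 1, hL, m, hm⟩ : T3Family) n K x₀ ρ S ((ℓ + 1) * Mh) hM) : (PBond (PV 2 ℓ m K hd3 hL) 0 → Matrix (Fin 2) (Fin 2) ℂ) → BondIdx (cubeSeqMT3 (⟨ℓ + 1, hL, m, hm⟩ : T3Family) n K x₀ ρ S ((ℓ + 1) * Mh) hM) → Matrix (Fin 2) (Fin 2) ℂ) 0) Hs
      (C₂ := (64 * ((ℓ + 1 : ℕ) : ℝ) / (16 * 3800 * (((((PV 2 ℓ m K hd3 hL)).d + 2) * ((PV 2 ℓ m K hd3 hL)).L : ℕ) : ℝ) ^ 2 * ((ℓ + 1 : ℕ) : ℝ))⁻¹)) (R := (16 * 3800 * (((((PV 2 ℓ m K hd3 hL)).d + 2) * ((PV 2 ℓ m K hd3 hL)).L : ℕ) : ℝ) ^ 2 * ((ℓ + 1 : ℕ) : ℝ))⁻¹ / 4) (B₀ := BH) (ε := ε)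
      hC₂0 hBH hΦd hΦq hHinv (fun X t _ hX b => (hH X t hX).1 b) hq h3ε hε
  -- (X2-C′) at the dressed point `Y − Hs (Dsel Y)` (§1)
  have hCcolC := hCcol_at_dressedPoint (w 1) (w 3) hw1 (⟨x₀, 0⟩ : PBond (PV 2 ℓ m K hd3 hL) 0) u Hs Dsel
    (fun Z δ : PBond (PV 2 ℓ m K hd3 hL) 0 → Matrix (Fin 2) (Fin 2) ℂ =>
      fderiv ℂ (fun A : PBond ((⟨ℓ + 1, hL, m, hm⟩ : T3Family).P K) 0 → Matrix (Fin 2) (Fin 2) ℂ => chartLogFlat (((((ℓ + 1 : ℕ) : ℝ))⁻¹) ^ (K - n)) (cubeSeqMT3 (⟨ℓ + 1, hL, m, hm⟩ : T3Family) n K x₀ ρ S ((ℓ + 1) * Mh) hM) A - fderiv ℂ (chartLogFlat (((((ℓ + 1 : ℕ) : ℝ))⁻¹) ^ (K - n)) (cubeSeqMT3 (⟨ℓ + 1, hL, m, hm⟩ : T3Family) n K x₀ ρ S ((ℓ + 1) * Mh) hM) : (PBond (PV 2 ℓ m K hd3 hL) 0 → Matrix (Fin 2) (Fin 2) ℂ)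 → BondIdx (cubeSeqMT3 (⟨ℓ + 1, hL, m, hm⟩ : T3Family) n K x₀ ρ S ((ℓ + 1) * Mh) hM) → Matrix (Fin 2) (Fin 2) ℂ) 0 A) Z δ)
    (fun (Y : PBond (PV 2 ℓ m K hd3 hL) 0 → Matrix (Fin 2) (Fin 2) ℂ) (r : ℝ) =>
      ∀ (b : PBond (PV 2 ℓ m K hd3 hL) 0) (ν : Fin 3), w 2 b * ((ℓ + 1 : ℕ) : ℝ) ^ (K - n) * ‖Y ⟨b.src.shift ν, b.dir⟩ - Y b‖ ≤ r)
    hBH hC₂0 (fun X t hX => (hH X t hX).1) hD hCcol hR'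
  -- FILE C at `H := Hs`, `D := Dsel`, `C := C♭`, every letter discharged but (X2-C′)♭ and the numerics
  obtain ⟨W₀, hgrad, hW₀d, hfin⟩ := exists_hWq_dressed_cubeSeq_T3_of_columnLetters (⟨ℓ + 1, hL, m, hm⟩ : T3Family) n K x₀ ρ S ((ℓ + 1) * Mh) hM hS hw u hu0 Hs
    (fun Z : PBond ((⟨ℓ + 1, hL, m, hm⟩ : T3Family).P K) 0 → Matrix (Fin 2) (Fin 2) ℂ => chartLogFlat (((((ℓ + 1 : ℕ) : ℝ))⁻¹) ^ (K - n)) (cubeSeqMT3 (⟨ℓ + 1, hL, m, hm⟩ : T3Family) n K x₀ ρ S ((ℓ + 1) * Mh) hM) Z - fderiv ℂ (chartLogFlat (((((ℓ + 1 : ℕ) : ℝ))⁻¹) ^ (K - n)) (cubeSeqMT3 (⟨ℓ + 1, hL, m, hm⟩ : T3Family) n K x₀ ρ S ((ℓ + 1) * Mh) hM) : (PBond (PV 2 ℓ m K hd3 hL) 0 → Matrix (Fin 2) (Fin 2) ℂ) → BondIdx (cubeSeqMT3 (⟨ℓ + 1, hL, m, hm⟩ : T3Family) n K x₀ ρ S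 ((ℓ + 1) * Mh) hM) → Matrix (Fin 2) (Fin 2) ℂ) 0 Z) Dsel
    hH hD hX1 h49 hDd hCd hCcolC hHcol hCH hsmall hC₃' hK₀ hCP2 hC₂0 hBH hR₀0 hR₀ ha₃ hθ
  exact ⟨Hs, Dsel, W₀, hHS, hHinv, hH, han, hfd, hpt, hD, h49, hDd, hCd, h73, hgrad, hW₀d, hfin⟩

end Summit.QuantumFields.YangMills.Theorems.HalvingDressingLetter

end
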